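import Literature.NumberTheory.Automorphic.QuadraticOrderUnitIndex
import Literature.NumberTheory.QuadraticFields.BinaryQuadraticFormsRepresentation
import HarnessLib

/-!
# Quadratic irrationals of `ℚ(γ) ⊆ D` and their binary quadratic forms

Topic `NumberTheory/Automorphic`; definitions with bodies and theorems (no named fact, no
`sorry`). Ninth brick of the Brandt-module side of the Eichler–Pizer trace identity: the algebra
of the dictionary between lattices `[1, τ]` of the imaginary quadratic field `ℚ(γ)` (inside a
division quaternion algebra `D`, `trd(γ)² < 4 nrd(γ)`) and primitive positive definite forms
(Cox §7.B, proof of Thm. 7.7, and Exercise 7.9).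

* `qCo` — rational coordinates `z = u + vγ` on `ℚ(γ)`; `qIm z = v` (the orientation).
* `IsRootOf τ f` — `a τ² + b τ + c = 0`; `primForm τ` — the unique primitive form with `a > 0`
  having the root `τ ∉ ℚ` (`primForm_unique`); `oform τ` — the *oriented* form (`b ↦ -b` when
  `qIm τ < 0`), so that `oform (-τ) = oform τ`.
* Möbius transforms `moeb τ p q r s = (pτ + q)(rτ + s)⁻¹`: `isRootOf_moeb` (root of
  `f·(s, -q; -r, p)`), `qIm_moeb` (orientation is multiplied by `ps - qr` up to a positive
  factor), `oform_moeb` (proper equivalence for `ps - qr = 1`).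

## References

* D. A. Cox, *Primes of the form x² + ny²*, 2nd ed. (2013), §7.B (7.8), Thm. 7.7 (proof),
  Exercise 7.9 [Cox2013].
-/

noncomputable section

open scoped Pointwise
open Literature.NumberTheory.QuadraticFields.Quadratic

universe u

namespace Literature.NumberTheory.Automorphic

namespace Brandt

variable {D : Type u} [Ring D] [Algebra ℚ D] [IsQuaternionAlgebra ℚ D] {γ τ : D}

/-! ### Rational coordinates on `ℚ(γ)` -/

open Classical in
/-- The rational coordinates `(u, v)` of `z = u + vγ ∈ ℚ(γ)` (junk `0` off `ℚ(γ)`). [folklore] -/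
def qCo (hD : ∀ x : D, x ≠ 0 → IsUnit x) (hγ : γ ∉ (⊥ : Subalgebra ℚ D)) (z : D) : ℚ × ℚ :=
  if hz : z ∈ Algebra.adjoin ℚ {γ} then
    ((exists_rat_eq_of_mem_adjoin hD hγ hz).choose, (exists_rat_eq_of_mem_adjoin hD hγ hz).choose_spec.choose)
  else 0

/-- `qCo (u + vγ) = (u, v)`. [folklore] -/
theorem qCo_ratCoords (hD : ∀ x : D, x ≠ 0 → IsUnit x) (hγ : γ ∉ (⊥ : Subalgebra ℚ D)) (r s : ℚ) :
    qCo hD hγ (algebraMap ℚ D r + s • γ) = (r, s) := by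
  classical
  have hz : algebraMap ℚ D r + s • γ ∈ Algebra.adjoin ℚ {γ} := ratCoords_mem_adjoin γ r s
  rw [qCo, dif_pos hz]
  obtain ⟨h1, h2⟩ := rat_coords_unique hγ (exists_rat_eq_of_mem_adjoin hD hγ hz).choose_spec.choose_spec
  exact Prod.ext h1.symm h2.symm

/-- `z = u + vγ` for `(u, v) = qCo z`, `z ∈ ℚ(γ)`. [folklore] -/
theorem eq_of_qCo (hD : ∀ x : D, x ≠ 0 → IsUnit x) (hγ : γ ∉ (⊥ : Subalgebra ℚ D)) {z : D}
    (hz : z ∈ Algebra.adjoin ℚ {γ}) :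
    z = algebraMap ℚ D (qCo hD hγ z).1 + (qCo hD hγ z).2 • γ := by
  obtain ⟨r, s, rfl⟩ := exists_rat_eq_of_mem_adjoin hD hγ hz
  rw [qCo_ratCoords]

/-- The orientation coordinate `v` of `z = u + vγ`. [folklore] -/
def qIm (hD : ∀ x : D, x ≠ 0 → IsUnit x) (hγ : γ ∉ (⊥ : Subalgebra ℚ D)) (z : D) : ℚ := (qCo hD hγ z).2

/-- `qIm (u + vγ) = v`. [folklore] -/
theorem qIm_ratCoords (hD : ∀ x : D, x ≠ 0 → IsUnit x) (hγ : γ ∉ (⊥ : Subalgebra ℚ D)) (r s : ℚ) :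
    qIm hD hγ (algebraMap ℚ D r + s • γ) = s := by
  rw [qIm, qCo_ratCoords]

/-- `z ∈ ℚ(γ)` lies in `ℚ` iff `qIm z = 0`. [folklore] -/
theorem mem_bot_iff_qIm_eq_zero (hD : ∀ x : D, x ≠ 0 → IsUnit x) (hγ : γ ∉ (⊥ : Subalgebra ℚ D))
    {z : D} (hz : z ∈ Algebra.adjoin ℚ {γ}) : z ∈ (⊥ : Subalgebra ℚ D) ↔ qIm hD hγ z = 0 := by
  obtain ⟨r, s, rfl⟩ := exists_rat_eq_of_mem_adjoin hD hγ hz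
  rw [qIm_ratCoords]
  constructor
  · intro h
    by_contra hs
    apply hγ
    rw [Algebra.mem_bot] at h ⊢
    obtain ⟨q, hq⟩ := h
    refine ⟨s⁻¹ * (q - r), ?_⟩
    have : s • γ = algebraMap ℚ D (q - r) := by rw [map_sub, hq]; abel
    rw [map_mul, ← this, Algebra.algebraMap_eq_smul_one, smul_mul_assoc, one_mul, smul_smul,
      inv_mul_cancel₀ hs, one_smul]
  · rintro rfl
    rw [zero_smul, add_zero]
    exact Subalgebra.algebraMap_mem _ _

/-- `qIm` is additive on `ℚ(γ)`. [folklore] -/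
theorem qIm_add (hD : ∀ x : D, x ≠ 0 → IsUnit x) (hγ : γ ∉ (⊥ : Subalgebra ℚ D)) {z w : D}
    (hz : z ∈ Algebra.adjoin ℚ {γ}) (hw : w ∈ Algebra.adjoin ℚ {γ}) :
    qIm hD hγ (z + w) = qIm hD hγ z + qIm hD hγ w := by
  obtain ⟨r, s, rfl⟩ := exists_rat_eq_of_mem_adjoin hD hγ hz
  obtain ⟨r', s', rfl⟩ := exists_rat_eq_of_mem_adjoin hD hγ hw
  have : algebraMap ℚ D r + s • γ + (algebraMap ℚ D r' + s' • γ) = algebraMap ℚ D (r + r') + (s + s') • γ := by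
    rw [map_add, add_smul]; abel
  rw [this, qIm_ratCoords, qIm_ratCoords, qIm_ratCoords]

/-- `qIm (c • z) = c qIm z`. [folklore] -/
theorem qIm_smul (hD : ∀ x : D, x ≠ 0 → IsUnit x) (hγ : γ ∉ (⊥ : Subalgebra ℚ D)) {z : D}
    (hz : z ∈ Algebra.adjoin ℚ {γ}) (c : ℚ) : qIm hD hγ (c • z) = c * qIm hD hγ z := by
  obtain ⟨r, s, rfl⟩ := exists_rat_eq_of_mem_adjoin hD hγ hz
  have : c • (algebraMap ℚ D r + s • γ) = algebraMap ℚ D (c * r) + (c * s) • γ := by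
    rw [smul_add, smul_smul, map_mul, Algebra.smul_def c (algebraMap ℚ D r)]
  rw [this, qIm_ratCoords, qIm_ratCoords]

/-- `qIm (-z) = -qIm z`. [folklore] -/
theorem qIm_neg (hD : ∀ x : D, x ≠ 0 → IsUnit x) (hγ : γ ∉ (⊥ : Subalgebra ℚ D)) {z : D}
    (hz : z ∈ Algebra.adjoin ℚ {γ}) : qIm hD hγ (-z) = -qIm hD hγ z := by
  rw [← neg_one_smul ℚ z, qIm_smul hD hγ hz, neg_one_mul]

/-- `qIm (algebraMap q) = 0`. [folklore] -/
theorem qIm_algebraMap (hD : ∀ x : D, x ≠ 0 → IsUnit x) (hγ : γ ∉ (⊥ : Subalgebra ℚ D)) (q : ℚ) :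
    qIm hD hγ (algebraMap ℚ D q) = 0 := by
  have : algebraMap ℚ D q = algebraMap ℚ D q + (0 : ℚ) • γ := by rw [zero_smul, add_zero]
  rw [this, qIm_ratCoords]

/-- `qIm 1 = 0`. [folklore] -/
theorem qIm_one (hD : ∀ x : D, x ≠ 0 → IsUnit x) (hγ : γ ∉ (⊥ : Subalgebra ℚ D)) :
    qIm hD hγ (1 : D) = 0 := by
  rw [← map_one (algebraMap ℚ D), qIm_algebraMap]

/-- `qIm` of the conjugate: `qIm z̄ = -qIm z`. [folklore] -/
theorem qIm_standardInvolution (hD : ∀ x : D, x ≠ 0 → IsUnit x) (hγ : γ ∉ (⊥ : Subalgebra ℚ D))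
    {z : D} (hz : z ∈ Algebra.adjoin ℚ {γ}) :
    qIm hD hγ (standardInvolution ℚ D z) = -qIm hD hγ z := by
  rw [standardInvolution_def, sub_eq_add_neg,
    qIm_add hD hγ (Subalgebra.algebraMap_mem _ _) (Subalgebra.neg_mem _ hz), qIm_algebraMap,
    qIm_neg hD hγ hz, zero_add]

/-! ### Reduced trace and norm on `ℚ(γ)` -/

/-- `nrd(u + vγ) = u² + uv trd(γ) + v² nrd(γ)`. [folklore] -/
theorem reducedNorm_ratCoords (r s : ℚ) :
    reducedNorm ℚ D (algebraMap ℚ D r + s • γ) = r ^ 2 + r * s * reducedTrace ℚ D γ + s ^ 2 * reducedNorm ℚ D γ := by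
  rw [reducedNorm_add, reducedNorm_algebraMap, reducedNorm_smul, standardInvolution_smul,
    mul_smul_comm, ← Algebra.smul_def, map_smul, map_smul, reducedTrace_standardInvolution]
  simp only [smul_eq_mul]
  ring

/-- `trd(u + vγ) = 2u + v trd(γ)`. [folklore] -/
theorem reducedTrace_ratCoords (r s : ℚ) :
    reducedTrace ℚ D (algebraMap ℚ D r + s • γ) = 2 * r + s * reducedTrace ℚ D γ := by
  rw [map_add, map_smul, reducedTrace_algebraMap_rat, smul_eq_mul]

/-- **`ℚ(γ)` is imaginary quadratic**: `trd(z)² - 4 nrd(z) = v² (trd(γ)² - 4 nrd(γ))` for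
`z = u + vγ`. [folklore] -/
theorem disc_ratCoords (r s : ℚ) :
    reducedTrace ℚ D (algebraMap ℚ D r + s • γ) ^ 2 - 4 * reducedNorm ℚ D (algebraMap ℚ D r + s • γ) =
      s ^ 2 * (reducedTrace ℚ D γ ^ 2 - 4 * reducedNorm ℚ D γ) := by
  rw [reducedTrace_ratCoords, reducedNorm_ratCoords]; ring

/-- **Positivity of the norm form**: `nrd(z) > 0` for `0 ≠ z ∈ ℚ(γ)` when
`trd(γ)² < 4 nrd(γ)`. [folklore] -/
theorem reducedNorm_pos_of_mem_adjoin (hD : ∀ x : D, x ≠ 0 → IsUnit x) (hγ : γ ∉ (⊥ : Subalgebra ℚ D))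
    (himag : reducedTrace ℚ D γ ^ 2 < 4 * reducedNorm ℚ D γ) {z : D} (hz : z ∈ Algebra.adjoin ℚ {γ})
    (hz0 : z ≠ 0) : 0 < reducedNorm ℚ D z := by
  obtain ⟨r, s, rfl⟩ := exists_rat_eq_of_mem_adjoin hD hγ hz
  rw [reducedNorm_ratCoords]
  have h4 : 4 * (r ^ 2 + r * s * reducedTrace ℚ D γ + s ^ 2 * reducedNorm ℚ D γ) =
      (2 * r + s * reducedTrace ℚ D γ) ^ 2 + s ^ 2 * (4 * reducedNorm ℚ D γ - reducedTrace ℚ D γ ^ 2) := by ring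
  by_cases hs : s = 0
  · subst hs
    have hr : r ≠ 0 := by
      rintro rfl
      exact hz0 (by rw [map_zero, zero_smul, add_zero])
    simp only [zero_mul, mul_zero, add_zero, zero_pow two_ne_zero]
    positivity
  · have : 0 < s ^ 2 * (4 * reducedNorm ℚ D γ - reducedTrace ℚ D γ ^ 2) :=
      mul_pos (by positivity) (by linarith)
    nlinarith [sq_nonneg (2 * r + s * reducedTrace ℚ D γ)]

/-! ### Roots and primitive forms -/

/-- `τ` is a root of the form `f = (a, b, c)`: `a τ² + b τ + c = 0` in `D`. [cite: Cox2013, §7.B (7.8)] -/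
def IsRootOf (τ : D) (f : BinQF) : Prop :=
  (f.a : ℚ) • (τ * τ) + (f.b : ℚ) • τ + algebraMap ℚ D (f.c : ℚ) = 0

omit [IsQuaternionAlgebra ℚ D] in
/-- Linear independence of `1, τ` for `τ ∉ ℚ`. [folklore] -/
theorem smul_one_add_smul_eq_zero_iff [Nontrivial D] {τ : D} (hτ : τ ∉ (⊥ : Subalgebra ℚ D)) {u v : ℚ} :
    algebraMap ℚ D u + v • τ = 0 ↔ u = 0 ∧ v = 0 := by
  constructor
  · intro h
    have hv : v = 0 := by
      by_contra hv
      apply hτ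
      rw [Algebra.mem_bot]
      refine ⟨-(v⁻¹ * u), ?_⟩
      have : v • τ = -algebraMap ℚ D u := eq_neg_of_add_eq_zero_right h
      have hτ' : τ = v⁻¹ • (-algebraMap ℚ D u) := by rw [← this, smul_smul, inv_mul_cancel₀ hv, one_smul]
      rw [hτ', map_neg, map_mul, Algebra.smul_def, mul_neg]
    subst hv
    rw [zero_smul, add_zero, map_eq_zero_iff _ (algebraMap ℚ D).injective] at h
    exact ⟨h, rfl⟩
  · rintro ⟨rfl, rfl⟩
    rw [map_zero, zero_smul, add_zero]

/-- **Root criterion**: `τ ∉ ℚ` is a root of `(a, b, c)` iff `b = -a trd(τ)` and `c = a nrd(τ)`. [cite: Cox2013, §7.B Lemma 7.5 (proof)] -/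
theorem isRootOf_iff (hτ : τ ∉ (⊥ : Subalgebra ℚ D)) (f : BinQF) :
    IsRootOf τ f ↔ (f.b : ℚ) = -f.a * reducedTrace ℚ D τ ∧ (f.c : ℚ) = f.a * reducedNorm ℚ D τ := by
  haveI : Nontrivial D := nontrivial_of_isQuaternionAlgebra
  have hτ2 : τ * τ = reducedTrace ℚ D τ • τ - algebraMap ℚ D (reducedNorm ℚ D τ) := by
    rw [mul_self_eq_reducedTrace_mul_sub_reducedNorm ℚ D τ, Algebra.smul_def]
  have key : (f.a : ℚ) • (τ * τ) + (f.b : ℚ) • τ + algebraMap ℚ D (f.c : ℚ) =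
      algebraMap ℚ D (f.c - f.a * reducedNorm ℚ D τ) + (f.a * reducedTrace ℚ D τ + f.b) • τ := by
    rw [hτ2, smul_sub, smul_smul, map_sub, map_mul, Algebra.smul_def (f.a : ℚ) (algebraMap ℚ D _), add_smul]
    abel
  rw [IsRootOf, key, smul_one_add_smul_eq_zero_iff hτ]
  constructor
  · rintro ⟨h1, h2⟩; constructor <;> linarith
  · rintro ⟨h1, h2⟩; constructor <;> linarith

/-- Bézout for a primitive form: `a x + b y + c z = 1`. [folklore] -/
theorem exists_bezout_of_isPrimitive {f : BinQF} (hf : f.IsPrimitive) :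
    ∃ x y z : ℤ, f.a * x + f.b * y + f.c * z = 1 := by
  have h1 : Int.gcd (Int.gcd f.a f.b : ℤ) f.c = 1 := by
    unfold BinQF.IsPrimitive at hf
    rw [Int.gcd, Int.natAbs_natCast]
    exact hf
  have e1 := Int.gcd_eq_gcd_ab (Int.gcd f.a f.b : ℤ) f.c
  have e2 := Int.gcd_eq_gcd_ab f.a f.b
  rw [h1, Nat.cast_one] at e1
  refine ⟨Int.gcdA f.a f.b * Int.gcdA (Int.gcd f.a f.b : ℤ) f.c,
    Int.gcdB f.a f.b * Int.gcdA (Int.gcd f.a f.b : ℤ) f.c, Int.gcdB (Int.gcd f.a f.b : ℤ) f.c, ?_⟩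
  linear_combination -e1 - Int.gcdA (↑(Int.gcd f.a f.b)) f.c * e2

/-- If `g.a f = f.a g` coefficientwise and `f` is primitive then `f.a ∣ g.a`. [folklore] -/
theorem a_dvd_a_of_proportional {f g : BinQF} (hb : g.a * f.b = f.a * g.b) (hc : g.a * f.c = f.a * g.c)
    (hfp : f.IsPrimitive) : f.a ∣ g.a := by
  obtain ⟨x, y, z, e⟩ := exists_bezout_of_isPrimitive hfp
  exact ⟨g.a * x + g.b * y + g.c * z, by linear_combination (-g.a) * e + y * hb + z * hc⟩

/-- **Two primitive forms with positive leading coefficients and a common root `τ ∉ ℚ` are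
equal.** [cite: Cox2013, §7.B (proof of Thm. 7.7, uniqueness of f(x,y))] -/
theorem eq_of_isRootOf {τ : D} (hτ : τ ∉ (⊥ : Subalgebra ℚ D)) {f g : BinQF} (hf : IsRootOf τ f)
    (hg : IsRootOf τ g) (hfp : f.IsPrimitive) (hgp : g.IsPrimitive) (hfa : 0 < f.a) (hga : 0 < g.a) :
    f = g := by
  rw [isRootOf_iff hτ] at hf hg
  have hb : g.a * f.b = f.a * g.b := by
    have : ((g.a * f.b : ℤ) : ℚ) = ((f.a * g.b : ℤ) : ℚ) := by push_cast; rw [hf.1, hg.1]; ring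
    exact_mod_cast this
  have hc : g.a * f.c = f.a * g.c := by
    have : ((g.a * f.c : ℤ) : ℚ) = ((f.a * g.c : ℤ) : ℚ) := by push_cast; rw [hf.2, hg.2]; ring
    exact_mod_cast this
  have h1 : f.a ∣ g.a := a_dvd_a_of_proportional hb hc hfp
  have h2 : g.a ∣ f.a := a_dvd_a_of_proportional hb.symm hc.symm hgp
  have ha : f.a = g.a := Int.dvd_antisymm hfa.le hga.le h1 h2
  have hfa0 : f.a ≠ 0 := hfa.ne'
  rw [← ha] at hb hc
  ext
  · exact ha
  · exact mul_left_cancel₀ hfa0 (by rw [mul_comm f.a g.b]; linarith [hb])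
  · exact mul_left_cancel₀ hfa0 (by rw [mul_comm f.a g.c]; linarith [hc])

/-- **Existence of the primitive form of a quadratic irrational**: every `τ ∈ ℚ(γ) ∖ ℚ` is a
root of a primitive form with `a > 0` (clear denominators in `X² - trd(τ) X + nrd(τ)` and divide
by the content). [cite: Cox2013, §7.B (proof of Thm. 7.7: "ax² + bx + c … relatively prime")] -/
theorem exists_isRootOf (hτ : τ ∉ (⊥ : Subalgebra ℚ D)) :
    ∃ f : BinQF, IsRootOf τ f ∧ f.IsPrimitive ∧ 0 < f.a := by
  set T := reducedTrace ℚ D τ with hT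
  set N := reducedNorm ℚ D τ with hN
  -- an integral equation
  set a₀ : ℤ := (T.den : ℤ) * N.den with ha₀
  set b₀ : ℤ := -(T.num * N.den) with hb₀
  set c₀ : ℤ := N.num * T.den with hc₀
  have ha₀pos : 0 < a₀ := mul_pos (by exact_mod_cast T.den_pos) (by exact_mod_cast N.den_pos)
  have hb₀Q : (b₀ : ℚ) = -a₀ * T := by
    rw [hb₀, ha₀]; push_cast
    have := Rat.mul_den_eq_num T
    linear_combination (N.den : ℚ) * this
  have hc₀Q : (c₀ : ℚ) = a₀ * N := by
    rw [hc₀, ha₀]; push_cast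
    have := Rat.mul_den_eq_num N
    linear_combination -(T.den : ℚ) * this
  -- divide by the content
  set g : ℕ := Int.gcd (Int.gcd a₀ b₀ : ℤ) c₀ with hg
  have hga : (g : ℤ) ∣ a₀ := (Int.gcd_dvd_left _ _).trans (Int.gcd_dvd_left _ _)
  have hgb : (g : ℤ) ∣ b₀ := (Int.gcd_dvd_left _ _).trans (Int.gcd_dvd_right _ _)
  have hgc : (g : ℤ) ∣ c₀ := Int.gcd_dvd_right _ _
  have hg0 : 0 < (g : ℤ) := by
    have : g ≠ 0 := fun h => by
      rw [h, Nat.cast_zero, zero_dvd_iff] at hga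
      exact ha₀pos.ne' hga
    exact_mod_cast Nat.pos_of_ne_zero this
  obtain ⟨a, ha⟩ := hga
  obtain ⟨b, hb⟩ := hgb
  obtain ⟨c, hc⟩ := hgc
  have hapos : 0 < a := by
    rw [ha] at ha₀pos
    exact pos_of_mul_pos_right ha₀pos hg0.le
  refine ⟨⟨a, b, c⟩, ?_, ?_, hapos⟩
  · rw [isRootOf_iff hτ]
    have hgQ : (g : ℚ) ≠ 0 := by exact_mod_cast hg0.ne'
    constructor
    · have e : ((g : ℤ) : ℚ) * b = -(((g : ℤ) : ℚ) * a) * T := by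
        have := hb₀Q; rw [hb, ha] at this; push_cast at this; exact this
      have e' : (g : ℚ) * (b + a * T) = 0 := by push_cast at e; linear_combination e
      rcases mul_eq_zero.mp e' with h | h
      · exact absurd h hgQ
      · change (b : ℚ) = -(a : ℚ) * T; linear_combination h
    · have e : ((g : ℤ) : ℚ) * c = ((g : ℤ) : ℚ) * a * N := by
        have := hc₀Q; rw [hc, ha] at this; push_cast at this; exact this
      have e' : (g : ℚ) * (c - a * N) = 0 := by push_cast at e; linear_combination e
      rcases mul_eq_zero.mp e' with h | h
      · exact absurd h hgQ
      · change (c : ℚ) = (a : ℚ) * N; linear_combination h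
  · rw [BinQF.isPrimitive_iff]
    intro d hda hdb hdc
    change d ∣ a at hda; change d ∣ b at hdb; change d ∣ c at hdc
    have h1 : (g : ℤ) * d ∣ a₀ := by rw [ha]; exact mul_dvd_mul_left _ hda
    have h2 : (g : ℤ) * d ∣ b₀ := by rw [hb]; exact mul_dvd_mul_left _ hdb
    have h3 : (g : ℤ) * d ∣ c₀ := by rw [hc]; exact mul_dvd_mul_left _ hdc
    have h4 : (g : ℤ) * d ∣ (g : ℤ) := by
      have := Int.dvd_coe_gcd (Int.dvd_coe_gcd h1 h2) h3
      rwa [← hg] at this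
    have : d ∣ 1 := by
      obtain ⟨k, hk⟩ := h4
      exact ⟨k, mul_left_cancel₀ hg0.ne' (by rw [mul_one]; rw [mul_assoc] at hk; exact hk)⟩
    exact isUnit_of_dvd_one this

open Classical in
/-- **The primitive form of `τ`**: the unique primitive `(a, b, c)` with `a > 0` and
`aτ² + bτ + c = 0` (junk off `ℚ(γ) ∖ ℚ`). [cite: Cox2013, §7.B (7.8)] -/
def primForm (τ : D) : BinQF :=
  if hτ : τ ∉ (⊥ : Subalgebra ℚ D) then (exists_isRootOf hτ).choose else ⟨1, 0, 1⟩

/-- `τ` is a root of its primitive form. [folklore] -/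
theorem isRootOf_primForm (hτ : τ ∉ (⊥ : Subalgebra ℚ D)) : IsRootOf τ (primForm τ) := by
  classical
  rw [primForm, dif_pos hτ]; exact (exists_isRootOf hτ).choose_spec.1

/-- The primitive form is primitive. [folklore] -/
theorem isPrimitive_primForm (hτ : τ ∉ (⊥ : Subalgebra ℚ D)) : (primForm τ).IsPrimitive := by
  classical
  rw [primForm, dif_pos hτ]; exact (exists_isRootOf hτ).choose_spec.2.1

/-- The primitive form has `a > 0`. [folklore] -/
theorem primForm_a_pos (hτ : τ ∉ (⊥ : Subalgebra ℚ D)) : 0 < (primForm τ).a := by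
  classical
  rw [primForm, dif_pos hτ]; exact (exists_isRootOf hτ).choose_spec.2.2

/-- **Uniqueness of the primitive form.** [cite: Cox2013, §7.B (proof of Thm. 7.7)] -/
theorem eq_primForm (hτ : τ ∉ (⊥ : Subalgebra ℚ D)) {f : BinQF} (hf : IsRootOf τ f) (hfp : f.IsPrimitive)
    (hfa : 0 < f.a) : f = primForm τ :=
  eq_of_isRootOf hτ hf (isRootOf_primForm hτ) hfp (isPrimitive_primForm hτ) hfa (primForm_a_pos hτ)

/-- **The discriminant of the primitive form** is `a² (trd(τ)² - 4 nrd(τ))`. [cite: Cox2013, §7.B Lemma 7.5 / Exercise 7.9] -/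
theorem disc_primForm (hτ : τ ∉ (⊥ : Subalgebra ℚ D)) :
    ((primForm τ).disc : ℚ) = (primForm τ).a ^ 2 * (reducedTrace ℚ D τ ^ 2 - 4 * reducedNorm ℚ D τ) := by
  obtain ⟨hb, hc⟩ := (isRootOf_iff hτ _).mp (isRootOf_primForm hτ)
  rw [BinQF.disc]; push_cast; rw [hb, hc]; ring

/-- The primitive form of `τ ∈ ℚ(γ) ∖ ℚ` is positive definite: `disc < 0`. [cite: Cox2013, §7.B (proof of Thm. 7.7: "positive definite")] -/
theorem disc_primForm_neg (hD : ∀ x : D, x ≠ 0 → IsUnit x) (hγ : γ ∉ (⊥ : Subalgebra ℚ D))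
    (himag : reducedTrace ℚ D γ ^ 2 < 4 * reducedNorm ℚ D γ) (hτK : τ ∈ Algebra.adjoin ℚ {γ})
    (hτ : τ ∉ (⊥ : Subalgebra ℚ D)) : (primForm τ).disc < 0 := by
  have h := disc_primForm hτ
  obtain ⟨r, s, rfl⟩ := exists_rat_eq_of_mem_adjoin hD hγ hτK
  rw [disc_ratCoords] at h
  have hs : s ≠ 0 := by
    intro hs; apply hτ
    rw [mem_bot_iff_qIm_eq_zero hD hγ hτK, qIm_ratCoords, hs]
  have ha := primForm_a_pos hτ
  have : ((primForm (algebraMap ℚ D r + s • γ)).disc : ℚ) < 0 := by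
    rw [h]
    have h1 : (0 : ℚ) < (primForm (algebraMap ℚ D r + s • γ)).a ^ 2 := by positivity
    have h2 : (0 : ℚ) < s ^ 2 := by positivity
    nlinarith [mul_pos h1 h2]
  exact_mod_cast this

/-! ### Flipping `b ↦ -b`, the oriented form, and `τ ↦ -τ` -/

/-- The form `(a, -b, c)` (the "opposite" form, root `-τ̄`). [cite: Cox2013, §7.B (proof of Thm. 7.7)] -/
def flipB (f : BinQF) : BinQF := ⟨f.a, -f.b, f.c⟩

omit [Ring D] [Algebra ℚ D] [IsQuaternionAlgebra ℚ D] in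
/-- `flipB` is an involution. [folklore] -/
theorem flipB_flipB (f : BinQF) : flipB (flipB f) = f := by
  cases f; simp [flipB]

omit [Ring D] [Algebra ℚ D] [IsQuaternionAlgebra ℚ D] in
/-- `flipB` preserves the discriminant. [folklore] -/
theorem disc_flipB (f : BinQF) : (flipB f).disc = f.disc := by
  simp [flipB, BinQF.disc]

omit [Ring D] [Algebra ℚ D] [IsQuaternionAlgebra ℚ D] in
/-- `flipB` preserves primitivity. [folklore] -/
theorem isPrimitive_flipB {f : BinQF} (h : f.IsPrimitive) : (flipB f).IsPrimitive := by
  unfold BinQF.IsPrimitive at h ⊢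
  simpa [flipB] using h

omit [Ring D] [Algebra ℚ D] [IsQuaternionAlgebra ℚ D] in
/-- `flipB` preserves `IsPosPrim`. [folklore] -/
theorem isPosPrim_flipB {Δ : ℤ} {f : BinQF} (h : f.IsPosPrim Δ) : (flipB f).IsPosPrim Δ :=
  ⟨by rw [disc_flipB, h.disc_eq], h.a_pos, isPrimitive_flipB h.primitive⟩

omit [IsQuaternionAlgebra ℚ D] in
/-- `-τ` is a root of the flipped form. [folklore] -/
theorem isRootOf_neg_flipB {f : BinQF} (h : IsRootOf τ f) : IsRootOf (-τ) (flipB f) := by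
  unfold IsRootOf at h ⊢
  simp only [flipB, neg_mul_neg, Int.cast_neg, neg_smul, smul_neg, neg_neg]
  exact h

omit [IsQuaternionAlgebra ℚ D] in
/-- `-τ ∉ ℚ` for `τ ∉ ℚ`. [folklore] -/
theorem neg_not_mem_bot (hτ : τ ∉ (⊥ : Subalgebra ℚ D)) : -τ ∉ (⊥ : Subalgebra ℚ D) := fun h => by
  apply hτ; simpa using Subalgebra.neg_mem _ h

/-- **`primForm (-τ) = flipB (primForm τ)`.** [folklore] -/
theorem primForm_neg (hτ : τ ∉ (⊥ : Subalgebra ℚ D)) : primForm (-τ) = flipB (primForm τ) :=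
  (eq_primForm (neg_not_mem_bot hτ) (isRootOf_neg_flipB (isRootOf_primForm hτ))
    (isPrimitive_flipB (isPrimitive_primForm hτ)) (primForm_a_pos hτ)).symm

open Classical in
/-- **The oriented form of `τ`**: `primForm τ` if `τ` is positively oriented (`qIm τ > 0`),
its flip otherwise; so that `oform τ` is the form whose positively oriented root spans
`[1, τ] = [1, -τ]`. [cite: Cox2013, §7.B (proof of Thm. 7.7, choice of sign of a)] -/
def oform (hD : ∀ x : D, x ≠ 0 → IsUnit x) (hγ : γ ∉ (⊥ : Subalgebra ℚ D)) (τ : D) : BinQF :=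
  if 0 < qIm hD hγ τ then primForm τ else flipB (primForm τ)

/-- `oform (-τ) = oform τ`. [folklore] -/
theorem oform_neg (hD : ∀ x : D, x ≠ 0 → IsUnit x) (hγ : γ ∉ (⊥ : Subalgebra ℚ D))
    (hτK : τ ∈ Algebra.adjoin ℚ {γ}) (hτ : τ ∉ (⊥ : Subalgebra ℚ D)) :
    oform hD hγ (-τ) = oform hD hγ τ := by
  classical
  have h0 : qIm hD hγ τ ≠ 0 := fun h => hτ ((mem_bot_iff_qIm_eq_zero hD hγ hτK).mpr h)
  unfold oform
  rw [qIm_neg hD hγ hτK, primForm_neg hτ]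
  rcases lt_or_gt_of_ne h0 with h | h
  · rw [if_pos (neg_pos.mpr h), if_neg (not_lt.mpr h.le)]
  · rw [if_neg (not_lt.mpr (neg_nonpos.mpr h.le)), if_pos h, flipB_flipB]

/-- The oriented form is primitive positive definite of discriminant `disc (primForm τ)`. [folklore] -/
theorem isPosPrim_oform (hD : ∀ x : D, x ≠ 0 → IsUnit x) (hγ : γ ∉ (⊥ : Subalgebra ℚ D))
    (hτ : τ ∉ (⊥ : Subalgebra ℚ D)) : (oform hD hγ τ).IsPosPrim (primForm τ).disc := by
  classical
  have h : (primForm τ).IsPosPrim (primForm τ).disc := ⟨rfl, primForm_a_pos hτ, isPrimitive_primForm hτ⟩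
  unfold oform
  split_ifs
  · exact h
  · exact isPosPrim_flipB h

/-- The discriminant of the oriented form. [folklore] -/
theorem disc_oform (hD : ∀ x : D, x ≠ 0 → IsUnit x) (hγ : γ ∉ (⊥ : Subalgebra ℚ D))
    (hτ : τ ∉ (⊥ : Subalgebra ℚ D)) : (oform hD hγ τ).disc = (primForm τ).disc :=
  (isPosPrim_oform hD hγ hτ).disc_eq

/-! ### Roots of the same form -/

/-- **The two roots of a form**: if `τ₁ ∉ ℚ` and a commuting `τ₂` are roots of the same form
with `a ≠ 0` then `τ₂ = τ₁` or `τ₂ = τ̄₁`. [cite: Cox2013, §7.B (proof of Thm. 7.7)] -/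
theorem eq_or_eq_standardInvolution_of_isRootOf (hD : ∀ x : D, x ≠ 0 → IsUnit x) {τ₁ τ₂ : D}
    (hτ₁ : τ₁ ∉ (⊥ : Subalgebra ℚ D)) (hτ₂ : τ₂ ∉ (⊥ : Subalgebra ℚ D)) {f : BinQF}
    (h₁ : IsRootOf τ₁ f) (h₂ : IsRootOf τ₂ f) (ha : f.a ≠ 0) (hcomm : τ₁ * τ₂ = τ₂ * τ₁) :
    τ₂ = τ₁ ∨ τ₂ = standardInvolution ℚ D τ₁ := by
  obtain ⟨hb₁, hc₁⟩ := (isRootOf_iff hτ₁ f).mp h₁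
  obtain ⟨hb₂, hc₂⟩ := (isRootOf_iff hτ₂ f).mp h₂
  have haQ : (f.a : ℚ) ≠ 0 := by exact_mod_cast ha
  have hT : reducedTrace ℚ D τ₂ = reducedTrace ℚ D τ₁ :=
    mul_left_cancel₀ (neg_ne_zero.mpr haQ) (by rw [← hb₁, ← hb₂])
  have hN : reducedNorm ℚ D τ₂ = reducedNorm ℚ D τ₁ := mul_left_cancel₀ haQ (by rw [← hc₁, ← hc₂])
  -- `(τ₂ - τ₁)(τ₂ - τ̄₁) = τ₂² - T τ₂ + N = 0`
  have key : (τ₂ - τ₁) * (τ₂ - standardInvolution ℚ D τ₁) = 0 := by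
    have e₂ := mul_self_eq_reducedTrace_mul_sub_reducedNorm ℚ D τ₂
    have e₁ := mul_standardInvolution_holds ℚ D τ₁
    rw [standardInvolution_def] at e₁ ⊢
    rw [hT, hN] at e₂
    have e₂' : τ₂ * τ₂ - algebraMap ℚ D (reducedTrace ℚ D τ₁) * τ₂ = -algebraMap ℚ D (reducedNorm ℚ D τ₁) := by
      rw [e₂]; abel
    have : (τ₂ - τ₁) * (τ₂ - (algebraMap ℚ D (reducedTrace ℚ D τ₁) - τ₁)) =
        (τ₂ * τ₂ - algebraMap ℚ D (reducedTrace ℚ D τ₁) * τ₂) + τ₁ * (algebraMap ℚ D (reducedTrace ℚ D τ₁) - τ₁)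
          + (τ₂ * τ₁ - τ₁ * τ₂) + (algebraMap ℚ D (reducedTrace ℚ D τ₁) * τ₂ - τ₂ * algebraMap ℚ D (reducedTrace ℚ D τ₁)) := by
      noncomm_ring
    rw [this, e₂', e₁, hcomm, sub_self, add_zero, Algebra.commutes, sub_self, add_zero, neg_add_cancel]
  rcases eq_or_ne (τ₂ - τ₁) 0 with h | h
  · exact Or.inl (sub_eq_zero.mp h)
  · right
    have hu := hD _ h
    have := congrArg (fun x => Ring.inverse (τ₂ - τ₁) * x) key
    simp only [← mul_assoc, Ring.inverse_mul_cancel _ hu, one_mul, mul_zero] at this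
    exact sub_eq_zero.mp this

/-- **Equal oriented forms span the same lattice direction**: `oform τ₁ = oform τ₂` forces
`τ₂ = τ₁` or `τ₂ = -τ₁`. [cite: Cox2013, §7.B (proof of Thm. 7.7, injectivity)] -/
theorem eq_or_eq_neg_of_oform_eq (hD : ∀ x : D, x ≠ 0 → IsUnit x) (hγ : γ ∉ (⊥ : Subalgebra ℚ D))
    {τ₁ τ₂ : D} (h₁K : τ₁ ∈ Algebra.adjoin ℚ {γ}) (hτ₁ : τ₁ ∉ (⊥ : Subalgebra ℚ D))
    (h₂K : τ₂ ∈ Algebra.adjoin ℚ {γ}) (hτ₂ : τ₂ ∉ (⊥ : Subalgebra ℚ D))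
    (h : oform hD hγ τ₁ = oform hD hγ τ₂) : τ₂ = τ₁ ∨ τ₂ = -τ₁ := by
  classical
  have hcommK : ∀ {x y : D}, x ∈ Algebra.adjoin ℚ {γ} → y ∈ Algebra.adjoin ℚ {γ} → x * y = y * x :=
    fun hx hy => Algebra.adjoin_singleton_comm (K := ℚ) γ _ hx _ hy
  have h01 : qIm hD hγ τ₁ ≠ 0 := fun e => hτ₁ ((mem_bot_iff_qIm_eq_zero hD hγ h₁K).mpr e)
  have h02 : qIm hD hγ τ₂ ≠ 0 := fun e => hτ₂ ((mem_bot_iff_qIm_eq_zero hD hγ h₂K).mpr e)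
  -- the root of `primForm τ₁` with the orientation of `τ₁` is `τ₁`
  have root_unique : ∀ {σ₁ σ₂ : D}, σ₁ ∈ Algebra.adjoin ℚ {γ} → σ₁ ∉ (⊥ : Subalgebra ℚ D) →
      σ₂ ∈ Algebra.adjoin ℚ {γ} → σ₂ ∉ (⊥ : Subalgebra ℚ D) → primForm σ₁ = primForm σ₂ →
      0 < qIm hD hγ σ₁ * qIm hD hγ σ₂ → σ₂ = σ₁ := by
    intro σ₁ σ₂ h1K h1 h2K h2 he hsign
    rcases eq_or_eq_standardInvolution_of_isRootOf hD h1 h2 (isRootOf_primForm h1)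
      (he ▸ isRootOf_primForm h2) (primForm_a_pos h1).ne' (hcommK h1K h2K) with e | e
    · exact e
    · exfalso
      rw [e, qIm_standardInvolution hD hγ h1K] at hsign
      nlinarith [sq_nonneg (qIm hD hγ σ₁)]
  unfold oform at h
  by_cases hs₁ : 0 < qIm hD hγ τ₁ <;> by_cases hs₂ : 0 < qIm hD hγ τ₂ <;> simp only [hs₁, hs₂, if_true, if_false] at h
  · exact Or.inl (root_unique h₁K hτ₁ h₂K hτ₂ h (mul_pos hs₁ hs₂))
  · -- `primForm τ₁ = flipB (primForm τ₂) = primForm (-τ₂)`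
    right
    have h' : primForm τ₁ = primForm (-τ₂) := by rw [primForm_neg hτ₂, h]
    have hs₂' : 0 < qIm hD hγ (-τ₂) := by
      rw [qIm_neg hD hγ h₂K]; exact neg_pos.mpr (lt_of_le_of_ne (not_lt.mp hs₂) h02)
    have := root_unique h₁K hτ₁ (Subalgebra.neg_mem _ h₂K) (neg_not_mem_bot hτ₂) h' (mul_pos hs₁ hs₂')
    rw [← this, neg_neg]
  · right
    have h' : primForm (-τ₁) = primForm τ₂ := by rw [primForm_neg hτ₁, h]
    have hs₁' : 0 < qIm hD hγ (-τ₁) := by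
      rw [qIm_neg hD hγ h₁K]; exact neg_pos.mpr (lt_of_le_of_ne (not_lt.mp hs₁) h01)
    exact root_unique (Subalgebra.neg_mem _ h₁K) (neg_not_mem_bot hτ₁) h₂K hτ₂ h' (mul_pos hs₁' hs₂)
  · have h' : primForm τ₁ = primForm τ₂ := by
      have := congrArg flipB h; rwa [flipB_flipB, flipB_flipB] at this
    have hn₁ : qIm hD hγ τ₁ < 0 := lt_of_le_of_ne (not_lt.mp hs₁) h01
    have hn₂ : qIm hD hγ τ₂ < 0 := lt_of_le_of_ne (not_lt.mp hs₂) h02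
    exact Or.inl (root_unique h₁K hτ₁ h₂K hτ₂ h' (mul_pos_of_neg_of_neg hn₁ hn₂))

/-! ### Möbius transformations -/

omit [IsQuaternionAlgebra ℚ D] in
/-- `IsRootOf` with integer casts instead of rational scalars. [folklore] -/
theorem isRootOf_iff_intCast {f : BinQF} :
    IsRootOf τ f ↔ (f.a : D) * (τ * τ) + (f.b : D) * τ + (f.c : D) = 0 := by
  unfold IsRootOf
  rw [map_intCast, Int.cast_smul_eq_zsmul, Int.cast_smul_eq_zsmul, zsmul_eq_mul, zsmul_eq_mul]

omit [IsQuaternionAlgebra ℚ D] in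
/-- `rτ + s ≠ 0` for `τ ∉ ℚ` unless `r = s = 0`. [folklore] -/
theorem linear_ne_zero [Nontrivial D] (hτ : τ ∉ (⊥ : Subalgebra ℚ D)) {r s : ℤ} (h : r ≠ 0 ∨ s ≠ 0) :
    (r : D) * τ + (s : D) ≠ 0 := by
  intro e
  have e' : algebraMap ℚ D (s : ℚ) + (r : ℚ) • τ = 0 := by
    rw [map_intCast, Int.cast_smul_eq_zsmul, zsmul_eq_mul, add_comm]; exact e
  obtain ⟨hs, hr⟩ := (smul_one_add_smul_eq_zero_iff hτ).mp e'
  rcases h with h | h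
  · exact h (by exact_mod_cast hr)
  · exact h (by exact_mod_cast hs)

/-- **The Möbius transform** `(pτ + q)(rτ + s)⁻¹` of `τ` (in the commutative field `ℚ(τ)`;
`Ring.inverse` is the inverse of the unit `rτ + s`). [cite: Cox2013, §7.B (proof of Thm. 7.7: "τ' = (pτ + q)/(rτ + s)")] -/
def moeb (τ : D) (p q r s : ℤ) : D := ((p : D) * τ + (q : D)) * Ring.inverse ((r : D) * τ + (s : D))

omit [IsQuaternionAlgebra ℚ D] [Algebra ℚ D] in
/-- An element commuting with a unit commutes with its `Ring.inverse`. [folklore] -/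
theorem comm_ringInverse {x z : D} (hz : IsUnit z) (h : x * z = z * x) :
    x * Ring.inverse z = Ring.inverse z * x := by
  have : Ring.inverse z * (x * z) * Ring.inverse z = Ring.inverse z * (z * x) * Ring.inverse z := by rw [h]
  rwa [mul_assoc, Ring.mul_inverse_cancel_right _ _ hz, ← mul_assoc, Ring.inverse_mul_cancel _ hz,
    one_mul, eq_comm] at this

omit [IsQuaternionAlgebra ℚ D] [Algebra ℚ D] in
/-- `pτ + q` with integer scalars. [folklore] -/
theorem linear_eq_zsmul (τ : D) (p q : ℤ) : (p : D) * τ + (q : D) = p • τ + q • (1 : D) := by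
  rw [zsmul_eq_mul, zsmul_one]

omit [IsQuaternionAlgebra ℚ D] in
/-- `IsRootOf` with integer scalars. [folklore] -/
theorem isRootOf_iff_zsmul {f : BinQF} : IsRootOf τ f ↔ f.a • (τ * τ) + f.b • τ + f.c • (1 : D) = 0 := by
  unfold IsRootOf
  rw [Int.cast_smul_eq_zsmul, Int.cast_smul_eq_zsmul, map_intCast, ← zsmul_one]

omit [IsQuaternionAlgebra ℚ D] [Algebra ℚ D] in
/-- Expansion of `a y² + b yz + c z²` for `y = Pτ + Q`, `z = Rτ + S`. [folklore] -/
theorem expand_quadratic (τ : D) (a b c P Q R S : ℤ) :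
    a • ((P • τ + Q • (1 : D)) * (P • τ + Q • (1 : D))) + b • ((P • τ + Q • (1 : D)) * (R • τ + S • (1 : D))) +
        c • ((R • τ + S • (1 : D)) * (R • τ + S • (1 : D))) =
      (a * P * P + b * P * R + c * R * R) • (τ * τ) + (2 * a * P * Q + b * (P * S + Q * R) + 2 * c * R * S) • τ +
        (a * Q * Q + b * Q * S + c * S * S) • (1 : D) := by
  simp only [add_mul, mul_add, smul_mul_assoc, mul_smul_comm, smul_smul, mul_one, one_mul, smul_add]
  module

omit [IsQuaternionAlgebra ℚ D] [Algebra ℚ D] in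
/-- `pτ + q` and `rτ + s` commute. [folklore] -/
theorem linear_comm (τ : D) (p q r s : ℤ) :
    ((p : D) * τ + (q : D)) * ((r : D) * τ + (s : D)) = ((r : D) * τ + (s : D)) * ((p : D) * τ + (q : D)) := by
  rw [linear_eq_zsmul, linear_eq_zsmul]
  simp only [add_mul, mul_add, smul_mul_assoc, mul_smul_comm, mul_one, one_mul]
  module

/-- **A Möbius transform of a root of `f` is a root of `f·(s, -q; -r, p)`** (any integer matrix
with `(r, s) ≠ 0`; for `ps - qr = 1` this is `f·γ⁻¹`). [cite: Cox2013, §7.B (proof of Thm. 7.7) and §2.A] -/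
theorem isRootOf_moeb (hD : ∀ x : D, x ≠ 0 → IsUnit x) (hτ : τ ∉ (⊥ : Subalgebra ℚ D)) {f : BinQF}
    (hf : IsRootOf τ f) {p q r s : ℤ} (hrs : r ≠ 0 ∨ s ≠ 0) :
    IsRootOf (moeb τ p q r s) (f.act s (-q) (-r) p) := by
  haveI : Nontrivial D := nontrivial_of_isQuaternionAlgebra
  set y : D := (p : D) * τ + (q : D) with hy
  set z : D := (r : D) * τ + (s : D) with hz
  have hzu : IsUnit z := hD z (linear_ne_zero hτ hrs)
  set w := Ring.inverse z with hw
  have hzw : z * w = 1 := Ring.mul_inverse_cancel _ hzu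
  have hyz : y * z = z * y := linear_comm τ p q r s
  have hyw : y * w = w * y := comm_ringInverse hzu hyz
  set g := f.act s (-q) (-r) p with hg
  rw [isRootOf_iff_zsmul] at hf ⊢
  have hm : moeb τ p q r s = y * w := rfl
  rw [hm]
  clear_value w y z
  have key : g.a • (y * y) + g.b • (y * z) + g.c • (z * z) =
      ((p * s - q * r) ^ 2) • (f.a • (τ * τ) + f.b • τ + f.c • (1 : D)) := by
    rw [hy, hz, linear_eq_zsmul, linear_eq_zsmul, expand_quadratic, hg]
    simp only [BinQF.act, smul_add, smul_smul]
    module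
  rw [hf, smul_zero] at key
  have h1 : y * w * (y * w) = y * y * (w * w) := by
    rw [mul_assoc, ← mul_assoc w y, ← hyw, mul_assoc, mul_assoc]
  have h2 : y * z * (w * w) = y * w := by rw [mul_assoc, ← mul_assoc z, hzw, one_mul]
  have h3 : z * z * (w * w) = 1 := by rw [mul_assoc, ← mul_assoc z w, hzw, one_mul, hzw]
  have e : g.a • (y * w * (y * w)) + g.b • (y * w) + g.c • (1 : D) =
      (g.a • (y * y) + g.b • (y * z) + g.c • (z * z)) * (w * w) := by
    rw [add_mul, add_mul, smul_mul_assoc, smul_mul_assoc, smul_mul_assoc, ← h1, h2, h3]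
  rw [e, key, zero_mul]

/-- The inverse of `z ∈ ℚ(γ)ˣ` is `nrd(z)⁻¹ z̄`. [cite: VignerasLNM800, Ch. I §1 Lemme 1.1] -/
theorem ringInverse_eq_smul_standardInvolution (hD : ∀ x : D, x ≠ 0 → IsUnit x) {z : D} (hz : z ≠ 0)
    (hN : reducedNorm ℚ D z ≠ 0) :
    Ring.inverse z = (reducedNorm ℚ D z)⁻¹ • standardInvolution ℚ D z := by
  have hzu := hD z hz
  have h : z * ((reducedNorm ℚ D z)⁻¹ • standardInvolution ℚ D z) = 1 := by
    rw [mul_smul_comm, mul_standardInvolution_holds ℚ D z, Algebra.algebraMap_eq_smul_one, smul_smul,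
      inv_mul_cancel₀ hN, one_smul]
  calc Ring.inverse z = Ring.inverse z * (z * ((reducedNorm ℚ D z)⁻¹ • standardInvolution ℚ D z)) := by
        rw [h, mul_one]
    _ = _ := Ring.inverse_mul_cancel_left _ _ hzu

/-- **Orientation of a Möbius transform**:
`qIm((pτ + q)/(rτ + s)) · nrd(rτ + s) = (ps - qr) · qIm(τ)` (and `nrd(rτ + s) > 0`). [cite: Cox2013, §7.B (proof of Thm. 7.7) / Exercise 7.9] -/
theorem qIm_moeb (hD : ∀ x : D, x ≠ 0 → IsUnit x) (hγ : γ ∉ (⊥ : Subalgebra ℚ D))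
    (himag : reducedTrace ℚ D γ ^ 2 < 4 * reducedNorm ℚ D γ) (hτK : τ ∈ Algebra.adjoin ℚ {γ})
    (hτ : τ ∉ (⊥ : Subalgebra ℚ D)) {p q r s : ℤ} (hrs : r ≠ 0 ∨ s ≠ 0) :
    qIm hD hγ (moeb τ p q r s) * reducedNorm ℚ D ((r : D) * τ + (s : D)) = (p * s - q * r) * qIm hD hγ τ ∧
      0 < reducedNorm ℚ D ((r : D) * τ + (s : D)) := by
  haveI : Nontrivial D := nontrivial_of_isQuaternionAlgebra
  set z : D := (r : D) * τ + (s : D) with hz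
  have hzK : z ∈ Algebra.adjoin ℚ {γ} :=
    Subalgebra.add_mem _ (Subalgebra.mul_mem _ (Subalgebra.intCast_mem _ r) hτK) (Subalgebra.intCast_mem _ s)
  have hyK : (p : D) * τ + (q : D) ∈ Algebra.adjoin ℚ {γ} :=
    Subalgebra.add_mem _ (Subalgebra.mul_mem _ (Subalgebra.intCast_mem _ p) hτK) (Subalgebra.intCast_mem _ q)
  have hz0 : z ≠ 0 := linear_ne_zero hτ hrs
  have hNpos : 0 < reducedNorm ℚ D z := reducedNorm_pos_of_mem_adjoin hD hγ himag hzK hz0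
  refine ⟨?_, hNpos⟩
  set T := reducedTrace ℚ D τ
  set N₀ := reducedNorm ℚ D τ
  have hτ2 : τ * τ = T • τ - N₀ • (1 : D) := by
    rw [mul_self_eq_reducedTrace_mul_sub_reducedNorm ℚ D τ, ← Algebra.smul_def, Algebra.algebraMap_eq_smul_one]
  have htrz : reducedTrace ℚ D z = r * T + 2 * s := by
    rw [hz, map_add, show (r : D) * τ = (r : ℚ) • τ by rw [Int.cast_smul_eq_zsmul, zsmul_eq_mul],
      map_smul, show ((s : ℤ) : D) = algebraMap ℚ D (s : ℚ) by rw [map_intCast], reducedTrace_algebraMap_rat,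
      smul_eq_mul]
  -- `(pτ + q) z̄ = (ps - qr) τ + c·1`
  have key : ((p : D) * τ + (q : D)) * standardInvolution ℚ D z =
      ((p * s - q * r : ℚ)) • τ + ((r * T + 2 * s) * q + p * r * N₀ - q * s : ℚ) • (1 : D) := by
    rw [standardInvolution_def, htrz, hz, Algebra.algebraMap_eq_smul_one,
      show ((p : ℤ) : D) = (p : ℚ) • (1 : D) by rw [Int.cast_smul_eq_zsmul, zsmul_eq_mul, mul_one],
      show ((q : ℤ) : D) = (q : ℚ) • (1 : D) by rw [Int.cast_smul_eq_zsmul, zsmul_eq_mul, mul_one],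
      show ((r : ℤ) : D) = (r : ℚ) • (1 : D) by rw [Int.cast_smul_eq_zsmul, zsmul_eq_mul, mul_one],
      show ((s : ℤ) : D) = (s : ℚ) • (1 : D) by rw [Int.cast_smul_eq_zsmul, zsmul_eq_mul, mul_one]]
    simp only [mul_sub, mul_add, add_mul, smul_mul_assoc, mul_smul_comm, one_mul, mul_one, hτ2,
      smul_sub, smul_add, smul_smul]
    module
  have hmoeb : moeb τ p q r s = (reducedNorm ℚ D z)⁻¹ • (((p : D) * τ + (q : D)) * standardInvolution ℚ D z) := by
    rw [moeb, ← hz, ringInverse_eq_smul_standardInvolution hD hz0 hNpos.ne', mul_smul_comm]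
  rw [hmoeb, qIm_smul hD hγ (Subalgebra.mul_mem _ hyK (by
      rw [standardInvolution_def]
      exact Subalgebra.sub_mem _ (Subalgebra.algebraMap_mem _ _) hzK)), key,
    qIm_add hD hγ (Subalgebra.smul_mem _ hτK _) (Subalgebra.smul_mem _ (Subalgebra.one_mem _) _),
    qIm_smul hD hγ hτK, qIm_smul hD hγ (Subalgebra.one_mem _), qIm_one, mul_zero, add_zero]
  field_simp

omit [Ring D] [Algebra ℚ D] [IsQuaternionAlgebra ℚ D] in
/-- `flipB (f·(s, -q; -r, p)) = (flipB f)·(s, q; r, p)`. [folklore] -/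
theorem flipB_act (f : BinQF) (p q r s : ℤ) : flipB (f.act s (-q) (-r) p) = (flipB f).act s q r p := by
  simp only [flipB, BinQF.act]
  ext <;> ring

/-- **Möbius transforms by `SL₂(ℤ)` give properly equivalent oriented forms.** [cite: Cox2013, §7.B (proof of Thm. 7.7: "f(x,y), g(x,y) are properly equivalent")] -/
theorem properEquiv_oform_moeb_of_det_one (hD : ∀ x : D, x ≠ 0 → IsUnit x) (hγ : γ ∉ (⊥ : Subalgebra ℚ D))
    (himag : reducedTrace ℚ D γ ^ 2 < 4 * reducedNorm ℚ D γ) (hτK : τ ∈ Algebra.adjoin ℚ {γ})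
    (hτ : τ ∉ (⊥ : Subalgebra ℚ D)) {p q r s : ℤ} (hdet : p * s - q * r = 1) :
    (oform hD hγ τ).ProperEquiv (oform hD hγ (moeb τ p q r s)) := by
  classical
  haveI : Nontrivial D := nontrivial_of_isQuaternionAlgebra
  have hrs : r ≠ 0 ∨ s ≠ 0 := by
    by_contra h; push Not at h; obtain ⟨rfl, rfl⟩ := h; simp at hdet
  set τ' := moeb τ p q r s with hτ'
  have hτ'K : τ' ∈ Algebra.adjoin ℚ {γ} := by
    have hzK : (r : D) * τ + (s : D) ∈ Algebra.adjoin ℚ {γ} :=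
      Subalgebra.add_mem _ (Subalgebra.mul_mem _ (Subalgebra.intCast_mem _ r) hτK) (Subalgebra.intCast_mem _ s)
    refine Subalgebra.mul_mem _ (Subalgebra.add_mem _ (Subalgebra.mul_mem _ (Subalgebra.intCast_mem _ p) hτK)
      (Subalgebra.intCast_mem _ q)) ?_
    have hu := hD _ (linear_ne_zero hτ hrs)
    rw [Ring.inverse_of_isUnit hu]
    exact inv_mem_adjoin_singleton hD γ (x := hu.unit) hzK
  obtain ⟨hsign, hNpos⟩ := qIm_moeb hD hγ himag hτK hτ (p := p) (q := q) hrs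
  have hdetQ : (p : ℚ) * s - q * r = 1 := by exact_mod_cast hdet
  rw [hdetQ, one_mul] at hsign
  have h0 : qIm hD hγ τ ≠ 0 := fun e => hτ ((mem_bot_iff_qIm_eq_zero hD hγ hτK).mpr e)
  -- orientation is preserved
  have hiff : 0 < qIm hD hγ τ' ↔ 0 < qIm hD hγ τ := by
    rw [← hτ'] at hsign
    constructor
    · intro h; rw [← hsign]; exact mul_pos h hNpos
    · intro h; rw [← hsign] at h; exact pos_of_mul_pos_left h hNpos.le
  have hτ'nb : τ' ∉ (⊥ : Subalgebra ℚ D) := by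
    rw [mem_bot_iff_qIm_eq_zero hD hγ hτ'K]
    intro e
    rw [← hτ', e, zero_mul] at hsign
    exact h0 hsign.symm
  -- the primitive form of `τ'`
  set f := primForm τ with hf
  have hfneg : f.disc < 0 := disc_primForm_neg hD hγ himag hτK hτ
  have hg : primForm τ' = f.act s (-q) (-r) p := by
    symm
    refine eq_primForm hτ'nb (isRootOf_moeb hD hτ (isRootOf_primForm hτ) hrs)
      ((isPrimitive_primForm hτ).act (by linear_combination hdet)) ?_
    rw [BinQF.a_act]
    exact BinQF.eval_pos _ (primForm_a_pos hτ) hfneg (by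
      rcases hrs with h | h
      · exact Or.inr (neg_ne_zero.mpr h)
      · exact Or.inl h)
  unfold oform
  by_cases hs : 0 < qIm hD hγ τ
  · rw [if_pos hs, if_pos (hiff.mpr hs), hg]
    exact ⟨s, -q, -r, p, by linear_combination hdet, rfl⟩
  · rw [if_neg hs, if_neg (fun h => hs (hiff.mp h)), hg, flipB_act]
    exact ⟨s, q, r, p, by linear_combination hdet, rfl⟩

omit [IsQuaternionAlgebra ℚ D] [Algebra ℚ D] in
/-- `moeb τ p q r s = moeb (-τ) (-p) q (-r) s`. [folklore] -/
theorem moeb_neg (τ : D) (p q r s : ℤ) : moeb (-τ) (-p) q (-r) s = moeb τ p q r s := by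
  simp [moeb]

/-- **Möbius transforms by `GL₂(ℤ)` give properly equivalent oriented forms** (`det = -1`
reduces to `det = 1` via `τ ↦ -τ`, `oform (-τ) = oform τ`). [cite: Cox2013, §7.B (proof of Thm. 7.7)] -/
theorem properEquiv_oform_moeb (hD : ∀ x : D, x ≠ 0 → IsUnit x) (hγ : γ ∉ (⊥ : Subalgebra ℚ D))
    (himag : reducedTrace ℚ D γ ^ 2 < 4 * reducedNorm ℚ D γ) (hτK : τ ∈ Algebra.adjoin ℚ {γ})
    (hτ : τ ∉ (⊥ : Subalgebra ℚ D)) {p q r s : ℤ} (hdet : p * s - q * r = 1 ∨ p * s - q * r = -1) :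
    (oform hD hγ τ).ProperEquiv (oform hD hγ (moeb τ p q r s)) := by
  rcases hdet with h | h
  · exact properEquiv_oform_moeb_of_det_one hD hγ himag hτK hτ h
  · rw [← moeb_neg, ← oform_neg hD hγ hτK hτ]
    exact properEquiv_oform_moeb_of_det_one hD hγ himag (Subalgebra.neg_mem _ hτK) (neg_not_mem_bot hτ)
      (by linear_combination -h)

end Brandt

end Literature.NumberTheory.Automorphic

end
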